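import Mathlib
import HarnessLib
import Literature.MathematicalPhysics.StatisticalMechanics.WeightDominatingH73All

/-!
# Domination of the seed of the weight tower at scale `0` (Adams–Buchholz–Kotecký–Müller (7.42))

The induction of [ABKM19] Lemma 7.5 (v) starts from (7.42):
`A_0^X ≤ (1−4θ̄)𝒜 + δ₀M₀ ≤ (1−3θ̄)𝒜 ≤ (λ^{-1}… )` i.e. `A_0^X ⪯ D_0 = (λM_0⁻¹ + (1+θ_0)𝒞)⁻¹` for
`δ_0 ≤ θ̄/Ω`, `λ ≤ ω`.  In multiplier form (`TorusMultiplierMatrices.lean`) this is the scalar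
inequality `(1−4θ̄)â/2… `; for the line of the crux (`1 − 4θ̄ = ½`, seed `½Σ_{x∈X}|∇φ(x)|² + δ'_0 M_0^X`)
it reads `â/2 + δ'_0 m_0 ≤ d_0 = (lam·m_0⁻¹ + (1+θ_0)·â⁻¹)⁻¹` at every non-zero mode, where
`â = symbR A` is the symbol of the Gaussian action, `m_0 = derivMul L 0 s ∈ [â…, K_s â]` and
`t_0 = Σ_j c_j = â⁻¹` (`sum_re_fourierCoeff_mul_symbR_eq_one`).  This file proves:

* `half_add_le_domScalar` — the scalar (7.42): `â/2 + δ m ≤ domScalar lam θ m â⁻¹` whenever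
  `0 < â ≤ m ≤ K â` and `(1/2 + δK)(1 + θ + lam) ≤ 1`;
* **`seed_le_of_multipliers`** — the hypothesis `hseed_le` of `WeightData.dominated_of_multipliers`
  from a multiplier bound on the seed: if `seed X ⪯ mulMat(â/2) + δ • mulMat(m_0)` then
  `seed X ⪯ mulMat (domMul lam θ m t 0)` (with `t 0 = â⁻¹` off the zero mode).

Everything is proved; no named fact.

## References
* S. Adams, S. Buchholz, R. Kotecký, S. Müller, arXiv:1910.13564, Lemma 7.5 (7.42)
  [AdamsBuchholzKoteckyMuller2019].
-/

noncomputable section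

namespace Literature.MathematicalPhysics.StatisticalMechanics.GradientRG

open Finset Real Matrix
open Literature.MathematicalPhysics.StatisticalMechanics.GradientFRD
  (mulMat mulMat_add mulMat_smul posSemidef_mulMat_sub)

/-- **The scalar (7.42)**: for `0 < a ≤ m ≤ K a`, `lam, δ ≥ 0`, `1 + θ > 0` and
`(1/2 + δ K)(1 + θ + lam) ≤ 1`: `a/2 + δ m ≤ (lam·m⁻¹ + (1+θ)·a⁻¹)⁻¹`.
[cite: AdamsBuchholzKoteckyMuller2019, Lemma 7.5 (7.42)] -/
theorem half_add_le_domScalar {a m K lam θ δ : ℝ} (ha : 0 < a) (ham : a ≤ m) (hmK : m ≤ K * a)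
    (hlam : 0 ≤ lam) (hθ : 0 < 1 + θ) (hδ : 0 ≤ δ) (hcond : (1 / 2 + δ * K) * (1 + θ + lam) ≤ 1) :
    a / 2 + δ * m ≤ domScalar lam θ m a⁻¹ := by
  have hm : 0 < m := lt_of_lt_of_le ha ham
  -- `d = (lam/m + (1+θ)/a)⁻¹ ≥ a/(1 + θ + lam)` since `lam/m ≤ lam/a`
  have hP : 0 < lam * m⁻¹ + (1 + θ) * a⁻¹ :=
    add_pos_of_nonneg_of_pos (mul_nonneg hlam (inv_nonneg.2 hm.le)) (mul_pos hθ (inv_pos.2 ha))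
  have hd : a / (1 + θ + lam) ≤ domScalar lam θ m a⁻¹ := by
    rw [domScalar, div_eq_mul_inv a]
    have h1 : lam * m⁻¹ + (1 + θ) * a⁻¹ ≤ (1 + θ + lam) * a⁻¹ := by
      have : m⁻¹ ≤ a⁻¹ := inv_anti₀ ha ham
      nlinarith [mul_le_mul_of_nonneg_left this hlam]
    have h2 : (lam * m⁻¹ + (1 + θ) * a⁻¹)⁻¹ ≥ ((1 + θ + lam) * a⁻¹)⁻¹ := inv_anti₀ hP h1
    rw [mul_inv, inv_inv] at h2
    calc a * (1 + θ + lam)⁻¹ = (1 + θ + lam)⁻¹ * a := mul_comm _ _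
      _ ≤ _ := h2
  -- `a/2 + δ m ≤ (1/2 + δK) a ≤ a/(1+θ+lam)`
  have h3 : a / 2 + δ * m ≤ (1 / 2 + δ * K) * a := by nlinarith [mul_le_mul_of_nonneg_left hmK hδ]
  have hpos : 0 < 1 + θ + lam := by linarith
  have h4 : (1 / 2 + δ * K) * a ≤ a / (1 + θ + lam) := by
    rw [le_div_iff₀ hpos]
    calc (1 / 2 + δ * K) * a * (1 + θ + lam) = ((1 / 2 + δ * K) * (1 + θ + lam)) * a := by ring
      _ ≤ 1 * a := mul_le_mul_of_nonneg_right hcond ha.le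
      _ = a := one_mul a
  linarith

variable {d M : ℕ} [NeZero M]

/-- **`hseed_le` from multipliers** ([ABKM19] (7.42) for the seed of the tower): suppose at every
non-zero mode `0 < â(κ) ≤ m 0 κ ≤ K â(κ)` and `t 0 κ = â(κ)⁻¹`, while `â(0) = m 0 0 = t 0 0 = 0`;
parameters `lam, δ ≥ 0`, `1 + θ 0 > 0`, `(1/2 + δK)(1 + θ 0 + lam) ≤ 1`.  If the seed is dominated in
multiplier form, `seed ⪯ mulMat(â/2) + δ • mulMat(m 0)`, then `seed ⪯ mulMat (domMul lam θ m t 0)`.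
[cite: AdamsBuchholzKoteckyMuller2019, Lemma 7.5 (7.42)] -/
theorem seed_le_of_multipliers {seed : Matrix (Fin d → ZMod M) (Fin d → ZMod M) ℝ}
    {ahat : (Fin d → ZMod M) → ℝ} {m t : ℕ → (Fin d → ZMod M) → ℝ} {θ : ℕ → ℝ} {lam K δ : ℝ}
    (ha_pos : ∀ κ, κ ≠ 0 → 0 < ahat κ) (ha_zero : ahat 0 = 0) (ham : ∀ κ, ahat κ ≤ m 0 κ)
    (hmK : ∀ κ, m 0 κ ≤ K * ahat κ) (hm_zero : m 0 0 = 0)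
    (ht : ∀ κ, κ ≠ 0 → t 0 κ = (ahat κ)⁻¹) (ht_zero : t 0 0 = 0)
    (hlam : 0 ≤ lam) (hθ : 0 < 1 + θ 0) (hδ : 0 ≤ δ) (hcond : (1 / 2 + δ * K) * (1 + θ 0 + lam) ≤ 1)
    (hseed : (mulMat (fun κ => ahat κ / 2) + δ • mulMat (m 0) - seed).PosSemidef) :
    (mulMat (domMul lam θ m t 0) - seed).PosSemidef := by
  -- scalar comparison of the two multiplier matrices
  have hcmp : (mulMat (domMul lam θ m t 0) - (mulMat (fun κ => ahat κ / 2) + δ • mulMat (m 0))).PosSemidef := by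
    have heq : mulMat (fun κ => ahat κ / 2) + δ • mulMat (m 0) =
        mulMat (fun κ => ahat κ / 2 + δ * m 0 κ) := by
      rw [mulMat_add, mulMat_smul]
    rw [heq]
    refine posSemidef_mulMat_sub fun κ => ?_
    by_cases hκ : κ = 0
    · subst hκ
      simp [domMul, domScalar, ha_zero, hm_zero, ht_zero]
    · rw [domMul, ht κ hκ]
      exact half_add_le_domScalar (ha_pos κ hκ) (ham κ) (hmK κ) hlam hθ hδ hcond
  have := hcmp.add hseed
  convert this using 1
  abel

end Literature.MathematicalPhysics.StatisticalMechanics.GradientRG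

end
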